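import Literature.IUT.HodgeArakelov.CohomologyAutOuterProofs
import Literature.IUT.HodgeArakelov.CohomologyLimitKummer

/-!
# [IUTchII] Cor 1.12 (i) for the shape `M^×_TM·∞θ(Π)`: `(−)^ι` does not depend on the representative of the
# `Δ_Ÿ(Π)`-OUTER class `ι` — the Kummer classes of `Δ_Ÿ`-fixed constants are FIXED by `Δ_Ÿ`-conjugation

Proof-only sequel (abc-iut cell, block C / wave W6, seat abc-iut-w6-d002; DAG node **IUTchII:Cor1.12(i)**; NO definition,
NO `Prop`-valued fact) to `CohomologyAutOuterProofs.lean` (p429690: `(−)^ι` is representative-independent on ∞-type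
classes, and on `M + X` GIVEN that `conj_c` is trivial up to torsion on `M`) and to abc-iut-w4-d007's
`CohomologyLimitKummer.lean` (p416543/p421864: the Kummer map `h1LimKummer : A →* lim_K H¹(H ⊓ K, A')` of a discrete
`Π`-module into abc-iut-L6-t1's genuine limit, with its `Π`-EQUIVARIANCE `h1LimConj_h1LimKummer`).

S. Mochizuki, *Inter-universal Teichmüller theory II*, kurims manuscript (Dec. 2020), Cor. 1.12 (i) p. 56 l.−2 – p. 57
l. 14 [cite: Mochizuki2012, Cor 1.12 (i) p.57]: "`Δ_Ÿ(Π) := Π_Ÿ(Π) ∩ Δ`, `ι` is a `Δ_Ÿ(Π)`-outer automorphism of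
`Π_Ÿ(Π)`" and the notation `(−)^ι`, applied in (ii) (p. 57 l. 17) to `{M^×_TM·∞θ(Π)}^ι` with (e) `M^×_TM·∞θ(Π) :=
M^×_TM(Π)·∞θ(Π)` and (c) `M^×_TM(Π) ↪ lim_J H¹(J, (l·Δ_Θ)(Π))` the Kummer classes of the constants ([AbsTopIII]
Def. 3.1 (vi)). WHY `Δ_Ÿ` AND NOT `Π_Ÿ`: elements of `Π_Ÿ(Π)` outside `Δ` move the constants (the genuine Galois
action on `k̄ˣ`, abc-iut-w4-d007's `h1LimConj_h1LimKummer : conj_σ (κ b) = κ (σ • b)`), so only `Δ_Ÿ(Π)` — the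
elements acting TRIVIALLY on the constants — fixes `M^×_TM`; on `∞θ(Π)` all of `Π_Ÿ(Π)` is trivial up to torsion
(p429690). PROVED here (classical Kummer/Galois bookkeeping over the cell's model objects; claim key of the interface
`Mochizuki2012`, DISPUTED; nothing of [IUTchII] is asserted; no side taken on [IUTchIII] Cor. 3.12):
* `h1LimConj_h1LimKummer_eq_self_of_smul_eq` — the Kummer class of a `σ`-FIXED element is FIXED by `conj_σ` in
  the limit; `isOfFinAddOrder_h1LimConj_sub_self_of_mem_kummer_image` — hence (trivially) fixed up to torsion on
  the Kummer image of any set of `σ`-fixed elements;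
* **`iotaInvariants_kummer_add_h1LimAutEquiv_eq_of_inner`** — for two automorphism pairs `(α₁, β₁)`,
  `(α₂, β₂) = (α₁, β₁) ∘ Inn(c)` with `c ∈ H = Π_Ÿ(Π)` acting trivially on a set of constants `O` (i.e. `c ∈ Δ_Ÿ(Π)`
  for `O = 𝒪^×_k̄`), the `ι`-invariants up to torsion of `κ(O) + X` COINCIDE for every set `X` of ∞-type classes —
  the `M^×_TM·∞θ(Π)` shape with BOTH inputs discharged;
* at the model `Π := Π^tp_{X̲̲}` (abc-iut-L6-t1's `etaleThetaDataOfSetting'`): `kummer_add_thetaInfty_iotaInvariants_eq_of_inner`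
  — the same with `X := ∞θ(Π)`.
-/

namespace Literature.IUT.HodgeArakelov

open Literature.AnabelianGeometry.EtaleTheta CohomologySystemOfContH1

noncomputable section

namespace CohomologySystemOfContH1

variable {P : TopGroup.{0}} {G' : Type} [Group G'] [TopologicalSpace G'] [IsTopologicalGroup G']
  (φ : P →* G') (A' : Subgroup G') [A'.Normal] [IsMulCommutative A'] (H : Subgroup P) [H.Normal]
  {A : Type} [CommGroup A] [MulDistribMulAction P A] [TopologicalSpace A] [RootableBy A ℕ]
  (c : CyclotomeCoefficients φ A' A)
  (hA : ∀ b : A, IsOpen (MulAction.stabilizer P b : Set P))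
  (hfi : ∀ b : A, (MulAction.stabilizer P b).FiniteIndex)

/-- **The Kummer class of a `σ`-fixed element is fixed by `conj_σ`** in `lim_K H¹(H ⊓ K, A')` (abc-iut-w4-d007's
equivariance `conj_σ (κ b) = κ (σ • b)` at `σ • b = b`): the sense in which `Δ = Ker(Π ↠ G_k)` — which acts
trivially on the constants `k̄ˣ` — fixes `M^×_TM(Π)`. [cite: MochizukiAbsTopIII2015, Definition 3.1 (i) p.66] -/
theorem h1LimConj_h1LimKummer_eq_self_of_smul_eq (σ : P) (b : A) (hb : σ • b = b) :
    h1LimConj φ A' H σ (Multiplicative.toAdd (h1LimKummer φ A' H c hA hfi b)) =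
      Multiplicative.toAdd (h1LimKummer φ A' H c hA hfi b) := by
  rw [h1LimConj_h1LimKummer, hb]

/-- Hence `conj_σ` is (trivially) trivial up to torsion on the Kummer image of any set `O` of `σ`-fixed elements —
the hypothesis `hM` of `iotaInvariants_image2_add_h1LimAutEquiv_eq_of_inner` (p429690) for `M := κ(O)`.
[cite: MochizukiAbsTopIII2015, Definition 3.1 (i) p.66] -/
theorem isOfFinAddOrder_h1LimConj_sub_self_of_mem_kummer_image (σ : P) {O : Set A} (hO : ∀ b ∈ O, σ • b = b)
    {m : h1Lim φ A' H ⊥}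
    (hm : m ∈ (fun b => Multiplicative.toAdd (h1LimKummer φ A' H c hA hfi b)) '' O) :
    IsOfFinAddOrder (h1LimConj φ A' H σ m - m) := by
  obtain ⟨b, hb, rfl⟩ := hm
  rw [h1LimConj_h1LimKummer_eq_self_of_smul_eq φ A' H c hA hfi σ b (hO b hb), sub_self]
  exact IsOfFinAddOrder.zero

/-- **[IUTchII] Cor. 1.12 (i) for the shape `M^×_TM·∞θ(Π)`: `{κ(O) + X}^ι` does not depend on the representative of
the `Δ_Ÿ(Π)`-outer class `ι`.** For two automorphism pairs `(α₁, β₁)`, `(α₂, β₂) = (α₁, β₁) ∘ Inn(c)` of `(Π, ·)`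
(compatible with `φ`, carrying `A'` onto itself, stabilising `H = Π_Ÿ(Π)`), with `c ∈ H` acting TRIVIALLY on the
set of constants `O ⊆ A` (`c ∈ Δ_Ÿ(Π)` when `O ⊆ k̄ˣ`), and any set `X` of ∞-type classes (e.g. `∞θ(Π)`), the
`ι`-invariants up to torsion of the sum set `κ(O) + X` for the two induced actions `h1LimAutEquiv` COINCIDE.
[cite: Mochizuki2012, Cor 1.12 (i) p.57] -/
theorem iotaInvariants_kummer_add_h1LimAutEquiv_eq_of_inner {α₁ α₂ : P ≃ₜ* P} {β₁ β₂ : G' ≃ₜ* G'}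
    (h₁ : ∀ g, β₁ (φ g) = φ (α₁ g)) (h₂ : ∀ g, β₂ (φ g) = φ (α₂ g))
    (hA₁ : ∀ a : G', a ∈ A' ↔ β₁ a ∈ A') (hA₂ : ∀ a : G', a ∈ A' ↔ β₂ a ∈ A')
    (hH₁ : ∀ x, x ∈ H ↔ α₁ x ∈ H) (hH₂ : ∀ x, x ∈ H ↔ α₂ x ∈ H) {c' : P} (hc' : c' ∈ H)
    (hα : ∀ g, α₂ g = α₁ (c' * g * c'⁻¹)) (hβ : ∀ a : G', a ∈ A' → β₂ a = β₁ (φ c' * a * (φ c')⁻¹))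
    {O : Set A} (hO : ∀ b ∈ O, c' • b = b) {X : Set (h1Lim φ A' H ⊥)}
    (hX : ∀ x ∈ X, ∃ n : ℕ, 0 < n ∧ ∃ t : h1Lim φ A' H ⊤,
      IsOfFinAddOrder (n • x - h1Res φ A' H (bot_le : (⊥ : Subgroup P) ≤ ⊤) t)) :
    iotaInvariants (iotaQuotOf (h1LimAutEquiv φ A' H α₂ β₂ h₂ hA₂ hH₂) : _ →+ _)
        (Set.image2 (· + ·) ((fun b => Multiplicative.toAdd (h1LimKummer φ A' H c hA hfi b)) '' O) X) =
      iotaInvariants (iotaQuotOf (h1LimAutEquiv φ A' H α₁ β₁ h₁ hA₁ hH₁) : _ →+ _)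
        (Set.image2 (· + ·) ((fun b => Multiplicative.toAdd (h1LimKummer φ A' H c hA hfi b)) '' O) X) :=
  iotaInvariants_image2_add_h1LimAutEquiv_eq_of_inner φ A' H h₁ h₂ hA₁ hA₂ hH₁ hH₂ hc' hα hβ
    (fun _ hm => isOfFinAddOrder_h1LimConj_sub_self_of_mem_kummer_image φ A' H c hA hfi c' hO hm) hX

end CohomologySystemOfContH1

/-! ### At the model `Π := Π^tp_{X̲̲}`: `{κ(O) + ∞θ(Π)}^ι` -/

namespace EtaleThetaDataOfSetting

variable {p : ℕ} [Fact p.Prime] {D : Literature.AnabelianGeometry.EtaleTheta.ThetaSetting p}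
  {E : D.EtaleThetaData} {l : ℕ} (C : E.DoubleUnderline l) [(PiYdd C).Normal] (hC : D.Compat)
  (hS : D.Sec2Hyps) (hchar : PiYddCharacteristic C) (S : ThetaSetting.{0}) (eS : (Pi C) ≃ₜ* S.PiX) (hl : S.l = l)
  {A : Type} [CommGroup A] [MulDistribMulAction (Pi C) A] [TopologicalSpace A] [RootableBy A ℕ]
  (c : CyclotomeCoefficients (phi C) (D.lDeltaTheta l) A)
  (hA : ∀ b : A, IsOpen (MulAction.stabilizer (Pi C) b : Set (Pi C)))
  (hfi : ∀ b : A, (MulAction.stabilizer (Pi C) b).FiniteIndex)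

/-- **[IUTchII] Cor. 1.12 (i) at the model, shape `M^×_TM·∞θ(Π)`**: for a discrete `Π^tp_{X̲̲}`-module of constants
`A` with its Kummer map `κ` into `lim_J H¹(Π^tp_{Ÿ̲̲} ∩ J, l·Δ_Θ)` (abc-iut-w4-d007, coefficients `c : Λ(A) → l·Δ_Θ`),
a set `O ⊆ A` and two automorphism pairs differing by `Inn(c')` with `c' ∈ Π^tp_{Ÿ̲̲}` FIXING `O` pointwise
(`c' ∈ Δ_Ÿ`), the sets `{κ(O) + ∞θ(Π)}^ι` for the two representatives COINCIDE.
[cite: Mochizuki2012, Cor 1.12 (i) p.57] -/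
theorem kummer_add_thetaInfty_iotaInvariants_eq_of_inner {α₁ α₂ : (Pi C) ≃ₜ* (Pi C)}
    {β₁ β₂ : D.GtpTheta ≃ₜ* D.GtpTheta}
    (h₁ : ∀ g, β₁ (phi C g) = phi C (α₁ g)) (h₂ : ∀ g, β₂ (phi C g) = phi C (α₂ g))
    (hA₁ : ∀ a : D.GtpTheta, a ∈ D.lDeltaTheta l ↔ β₁ a ∈ D.lDeltaTheta l)
    (hA₂ : ∀ a : D.GtpTheta, a ∈ D.lDeltaTheta l ↔ β₂ a ∈ D.lDeltaTheta l)
    (hH₁ : ∀ x, x ∈ PiYdd C ↔ α₁ x ∈ PiYdd C) (hH₂ : ∀ x, x ∈ PiYdd C ↔ α₂ x ∈ PiYdd C)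
    {c' : Pi C} (hc' : c' ∈ PiYdd C) (hα : ∀ g, α₂ g = α₁ (c' * g * c'⁻¹))
    (hβ : ∀ a : D.GtpTheta, a ∈ D.lDeltaTheta l → β₂ a = β₁ (phi C c' * a * (phi C c')⁻¹))
    {O : Set A} (hO : ∀ b ∈ O, c' • b = b) :
    iotaInvariants (L := h1Lim (phi C) (D.lDeltaTheta l) (PiYdd C) ⊥)
        (iotaQuotOf (h1LimAutEquiv (phi C) (D.lDeltaTheta l) (PiYdd C) α₂ β₂ h₂ hA₂ hH₂) : _ →+ _)
        (Set.image2 (· + ·)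
          ((fun b => Multiplicative.toAdd
            (CohomologySystemOfContH1.h1LimKummer (phi C) (D.lDeltaTheta l) (PiYdd C) c hA hfi b)) '' O)
          (etaleThetaDataOfSetting' C hC hS hchar S eS hl).thetaInfty) =
      iotaInvariants (L := h1Lim (phi C) (D.lDeltaTheta l) (PiYdd C) ⊥)
        (iotaQuotOf (h1LimAutEquiv (phi C) (D.lDeltaTheta l) (PiYdd C) α₁ β₁ h₁ hA₁ hH₁) : _ →+ _)
        (Set.image2 (· + ·)
          ((fun b => Multiplicative.toAdd
            (CohomologySystemOfContH1.h1LimKummer (phi C) (D.lDeltaTheta l) (PiYdd C) c hA hfi b)) '' O)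
          (etaleThetaDataOfSetting' C hC hS hchar S eS hl).thetaInfty) :=
  CohomologySystemOfContH1.iotaInvariants_kummer_add_h1LimAutEquiv_eq_of_inner (phi C) (D.lDeltaTheta l)
    (PiYdd C) c hA hfi h₁ h₂ hA₁ hA₂ hH₁ hH₂ hc' hα hβ hO fun x hx => by
      obtain ⟨n, hn, t, _, ht⟩ := hx
      exact ⟨n, hn, t, ht⟩

end EtaleThetaDataOfSetting

end

end Literature.IUT.HodgeArakelov
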